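import Literature.NumberTheory.EllipticCurves.Kramer1981.LocalNormCokernel
import Literature.NumberTheory.EllipticCurves.Kramer1981.RamifiedNormIndexLocalLemmas
import Literature.NumberTheory.EllipticCurves.TateCurve.UniformizationProofs
import Literature.NumberTheory.EllipticCurves.TateCurve.UniformizationHolds
import Literature.NumberTheory.EllipticCurves.VariableChangePointsMap
import Literature.NumberTheory.GaloisRepresentations.LocalReciprocityLawDischargeProofs
import Literature.NumberTheory.QuadraticForms.QuadraticNormLocalCFT
import HarnessLib

/-!
# Kramer 1981, §2 Proposition 1 — PROVED: the local norm index of a Tate curve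
# (split multiplicative reduction) for a quadratic extension `K/F` of a `p`-adic field

Theorems only (no definition, no named fact, nothing asserted; D-0014 / D-0026). This file proves
clause (1) of the named fact
`Literature.NumberTheory.EllipticCurves.Kramer1981.props1_2a_multiplicativeNormIndex`
(`Kramer1981/LocalNormCokernel.lean`), i.e. K. Kramer, *Arithmetic of elliptic curves upon
quadratic extension*, Trans. Amer. Math. Soc. 264 (1981) 121–135, §2 **Proposition 1** (p. 123),
AS PRINTED and with the fact's binders: `prop1_splitMultiplicativeNormIndex`. Clause (2), Prop. 2 (a)
(the twisted Tate curve / non-split multiplicative reduction), is NOT proved here, so the fact itself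
stays a `def`; once Prop. 2 (a) is a theorem `T`, `props1_2a_multiplicativeNormIndex_holds` is
`fun F … hx => ⟨prop1_splitMultiplicativeNormIndex F … hx, T F … hx⟩` (checked in scratch).

## The printed statement and proof (held text `paper:doi-10-1090-s0002-9947-1981-0597871-8`,
## p0004 = p. 123)

[L8–L15] "Throughout this section, `F` is a finite extension of `ℚ_p` … `E` is an elliptic curve
defined over `F`, with an integral model whose discriminant `Δ` has minimal valuation. We consider
those `d ∈ F` for which `K = F(d^{1/2})` is a quadratic extension of `F`. The cokernel of the local
norm mapping `N : E(K) → E(F)` is a finite vector space over `F_2` whose dimension we denote by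
`i(K/F)`." [L18–L28] "If `E` is a Tate curve [7, p. 197] over `F`, then there is an element `q` in
`F` with `Δ = q ∏ (1 - q^n)^{24}` such that `E` is isomorphic to `G_m/q^ℤ` via a parametrization by
`p`-adic theta functions." [L42–L43] "**PROPOSITION 1.** Suppose that `E` is a Tate curve. Then
`i(K/F)` is `0` or `1`, according to whether `(Δ, d)_F` is `-1` or `+1`." [L45–L51] "PROOF. From
the explicit formulas for parametrization by `p`-adic theta functions [7, p. 197] one sees that the
norm mapping on `E` corresponds to field-theoretic norm modulo `q^ℤ`. Thus
`E(F)/N{E(K)} = F*/(NK*)q^ℤ`. By local class field theory, `i(K/F)` therefore is at most `1`, and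
`i(K/F) = 1` precisely when `q ∈ NK*`, or equivalently when `(Δ, d)_F = +1`. Here and again later
on we use the fact that `Δq^{-1}` is a square in `F`."

## The proof here = the printed proof, on tree theorems

* "`E` is isomorphic to `G_m/q^ℤ`" — Tate's uniformisation is a tree THEOREM:
  `TateCurve.exists_tateParameter_of_hasSplitMultiplicativeReduction'` (Silverman ATAEC V.5.3 with
  AEC VII.5.1 (b): split multiplicative ⇒ `E ≅_F E_q`, `0 < |q| < 1`) and
  `TateCurve.uniformization_holds` (ATAEC V.3.1 (c),(d): `φ : F̄^*/q^ℤ ⥲ E_q(F̄)`, `Γ_F`-equivariant,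
  `L^*/q^ℤ ⥲ E_q(L)` for every `L`), abc-iut cell, `TateCurve/Uniformization*.lean`. §§1–4 below
  transport it into the currency of the fact (`KramerTunnell1982/UnramifiedNormIndex.lean`:
  points of `E.baseChange K'` for an intermediate field `K' ⊆ F̄`, `σ ∈ Aut(K'/F)` acting by
  `Affine.Point.map σ`): for EVERY `K'`, a surjective homomorphism `f : K'ˣ → E(K')` with kernel
  `q^ℤ` and `f(σu) = σ f(u)` (`exists_splitMultiplicative_uniformizer`), together with
  "`Δq^{-1}` is a square in `F`" (`Δ(E_q) = q ∏(1-q^n)^{24} = q·(∏(1-q^n)^{12})²`, and the minimal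
  model differs from `E_q` by a change of variables, `Δ ↦ u^{-12}Δ`).
* "the norm mapping on `E` corresponds to field-theoretic norm modulo `q^ℤ`. Thus
  `E(F)/N{E(K)} = F*/(NK*)q^ℤ`" — §§5–7: `E(K')^σ = f(Fˣ)` (a point `f(u)` is `σ`-fixed iff
  `σu/u ∈ q^ℤ`, iff `σu = u` as `q` is not a root of unity, iff `u ∈ F`), `N E(K') = f(N_{K'/F}K'ˣ)`
  (`f(u) + σf(u) = f(u·σu)`, `u·σu = s² - dt²`), hence the relative index equals the index of
  `q^ℤ·N_{K'/F}K'ˣ` in `Fˣ` (`relIndex_normSubgroup_fixedSubgroup_of_index_eq_two`).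
* "By local class field theory, `i(K/F)` therefore is at most `1`, and `i(K/F) = 1` precisely when
  `q ∈ NK*`" — the fundamental equality `[Fˣ : N_{F(√d)/F}] = 2` for an ABSTRACT non-archimedean
  local field of characteristic `0` is a tree THEOREM
  (`GaloisRepresentations.index_normSubgroup_eq_finrank_holds`, Serre *Local Fields* XIII §4 Prop. 9,
  specialised by `QuadraticForms.index_quadraticNormSubgroup_eq_two_of_index_normSubgroup_eq_finrank`,
  O'Meara 63:13a); "or equivalently when `(Δ, d)_F = +1`" —
  `QuadraticForms.hilbertSymbol_eq_one_iff_mem_quadraticNormSubgroup` and "`Δq^{-1}` is a square".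

Deviations from print (roads, not content): the explicit theta-function formulas are replaced by the
abstract clauses of `uniformization` (surjective, kernel `q^ℤ`, equivariant, descent); `K'` is ANY
quadratic `F(√d) ⊆ F̄` (ramified or not, any residue characteristic, `2` included), exactly as in the
fact. Nothing is weakened: the theorem is clause (1) of the fact verbatim.

HONEST FRAMING (cell `bsd-uniform`, track U2; `pub/bsd-uniform/u2/INGREDIENTS.md` §6, RESIDUE
R2-5): a local lemma of the `2`-descent bookkeeping at a split multiplicative prime becomes a theorem;
the named fact `props1_2a_multiplicativeNormIndex` is NOT discharged (Prop. 2 (a) open); no density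
or conversion number of the cell changes; no per-curve certificate is involved.

## References

* [Kramer1981] K. Kramer, *Arithmetic of elliptic curves upon quadratic extension*, Trans. Amer.
  Math. Soc. 264 (1981) 121–135, §2 Prop. 1 and its proof (p. 123).
* [SilvermanATAEC1994] J. H. Silverman, *Advanced Topics in the Arithmetic of Elliptic Curves*,
  GTM 151 (1994), Thm. V.3.1 (c),(d), Thm. V.5.3.
* [SerreLocalFields1979] J.-P. Serre, *Local Fields*, GTM 67 (1979), Ch. XIII §4 Prop. 9.
* [Omeara1963] O. T. O'Meara, *Introduction to quadratic forms* (1963), §63B, 63:13a.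
* [SilvermanAEC2009] J. H. Silverman, *The Arithmetic of Elliptic Curves*, 2nd ed. (2009), I.§1,
  VIII.§1 (Galois action on points and descent), III.3.1 (b).
-/

noncomputable section

open scoped Classical

open ValuativeRel Field WeierstrassCurve Filter Topology
open Literature.NumberTheory.GaloisRepresentations
open Literature.NumberTheory.GaloisRepresentations.IsNonarchimedeanLocalField
open Literature.NumberTheory.EllipticCurves.TateCurve
open Literature.NumberTheory.EllipticCurves.SteinWuthrich2013
open Literature.NumberTheory.EllipticCurves.KramerTunnell1982
open Literature.NumberTheory.QuadraticForms

namespace Literature.NumberTheory.EllipticCurves.Kramer1981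

universe u

/-! ## §1 Rational points over an intermediate field `K' ⊆ F̄` inside `E(F̄)` (descent) -/

section Descent

variable {F : Type u} [Field F] (W : WeierstrassCurve F)
  (K' : IntermediateField F (AlgebraicClosure F))

/-- The image in `E(F̄)` of a `K'`-rational point is fixed by `Gal(F̄/K')` (Galois acts on
coordinates; Silverman AEC I.§1, VIII.§1). [cite: SilvermanAEC2009, I.§1 and VIII.§1] -/
theorem smul_map_val_of_mem_fixingSubgroup (P₀ : (W.baseChange K').toAffine.Point)
    (τ : AlgebraicClosure F ≃ₐ[F] AlgebraicClosure F) (hτ : τ ∈ K'.fixingSubgroup) :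
    τ • Affine.Point.map (W' := W) (IntermediateField.val K') P₀ =
      Affine.Point.map (W' := W) (IntermediateField.val K') P₀ := by
  have hcomp : (τ : AlgebraicClosure F →ₐ[F] AlgebraicClosure F).comp (IntermediateField.val K') =
      IntermediateField.val K' := by
    apply AlgHom.ext
    intro x
    rw [IntermediateField.mem_fixingSubgroup_iff] at hτ
    exact hτ x x.2
  rw [WeierstrassCurve.smul_def, Affine.Point.map_map, hcomp]

/-- **Galois descent for points, relative form**: a point of `E(F̄)` fixed by `Gal(F̄/K')` is the
image of a `K'`-rational point (coordinates fixed by `Gal(F̄/K')` lie in `K'` by the infinite Galois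
correspondence, Mathlib `InfiniteGalois.fixedField_fixingSubgroup`, `F̄/F` being Galois in
characteristic `0`; nonsingularity descends along the injection `K' → F̄`). Silverman AEC I.§1
"`V(K) = {P ∈ V : P^σ = P for all σ ∈ G_{K̄/K}}`", VIII.§1; the case `K' = F` is the tree's
`fixedPoints_eq_range_map_holds`. [cite: SilvermanAEC2009, I.§1 and VIII.§1] -/
theorem exists_map_val_eq_of_forall_smul_eq [CharZero F]
    (P : (W.baseChange (AlgebraicClosure F)).toAffine.Point)
    (hP : ∀ τ : AlgebraicClosure F ≃ₐ[F] AlgebraicClosure F, τ ∈ K'.fixingSubgroup → τ • P = P) :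
    ∃ P₀ : (W.baseChange K').toAffine.Point,
      Affine.Point.map (W' := W) (IntermediateField.val K') P₀ = P := by
  haveI : IsGalois F (AlgebraicClosure F) := {}
  have hfix : ∀ z : AlgebraicClosure F,
      (∀ τ : AlgebraicClosure F ≃ₐ[F] AlgebraicClosure F, τ ∈ K'.fixingSubgroup → τ z = z) →
      z ∈ K' := by
    intro z hz
    rw [← InfiniteGalois.fixedField_fixingSubgroup K']
    exact (IntermediateField.mem_fixedField_iff _ z).mpr fun τ hτ => hz τ hτ
  rcases P with _ | ⟨x, y, h⟩
  · exact ⟨0, rfl⟩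
  · have hxy : ∀ τ : AlgebraicClosure F ≃ₐ[F] AlgebraicClosure F, τ ∈ K'.fixingSubgroup →
        τ x = x ∧ τ y = y := by
      intro τ hτ
      have e := hP τ hτ
      rw [WeierstrassCurve.smul_def, Affine.Point.map_some] at e
      simpa only [Affine.Point.some.injEq, AlgEquiv.coe_toAlgHom] using e
    have hx : x ∈ K' := hfix x fun τ hτ => (hxy τ hτ).1
    have hy : y ∈ K' := hfix y fun τ hτ => (hxy τ hτ).2
    have h₀ : (W.baseChange K').toAffine.Nonsingular ⟨x, hx⟩ ⟨y, hy⟩ :=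
      (Affine.baseChange_nonsingular W (f := IntermediateField.val K')
        (IntermediateField.val K').injective ⟨x, hx⟩ ⟨y, hy⟩).mp h
    exact ⟨Affine.Point.some ⟨x, hx⟩ ⟨y, hy⟩ h₀, rfl⟩

/-- An automorphism `σ ∈ Aut(K'/F)` acts on the image of a `K'`-point in `E(F̄)` through any lift
of `σ` to `F̄` — here Mathlib's `σ.liftNormal F̄` (`F̄/F` is normal); the Galois action on points
is functorial in the field (Silverman AEC VIII.§1). [cite: SilvermanAEC2009, VIII.§1 (the action of G_{K̄/K} on E(K̄))] -/
theorem map_val_map_algEquiv (σ : K' ≃ₐ[F] K') (P₀ : (W.baseChange K').toAffine.Point) :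
    Affine.Point.map (W' := W) (IntermediateField.val K')
        (Affine.Point.map (W' := W) (σ : K' →ₐ[F] K') P₀) =
      σ.liftNormal (AlgebraicClosure F) •
        Affine.Point.map (W' := W) (IntermediateField.val K') P₀ := by
  have hcomp : (IntermediateField.val K').comp (σ : K' →ₐ[F] K') =
      ((σ.liftNormal (AlgebraicClosure F) : AlgebraicClosure F ≃ₐ[F] AlgebraicClosure F) :
        AlgebraicClosure F →ₐ[F] AlgebraicClosure F).comp (IntermediateField.val K') := by
    apply AlgHom.ext
    intro x
    change ((σ x : K') : AlgebraicClosure F) = σ.liftNormal (AlgebraicClosure F) (x : AlgebraicClosure F)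
    exact (AlgEquiv.liftNormal_commutes σ (AlgebraicClosure F) x).symm
  rw [WeierstrassCurve.smul_def, Affine.Point.map_map, Affine.Point.map_map, hcomp]

/-- The lift `σ.liftNormal F̄` restricts to `σ` on `K'` (Mathlib `AlgEquiv.liftNormal_commutes`,
in the coercion form used here). Private helper. [folklore] -/
private theorem liftNormal_apply_coe (σ : K' ≃ₐ[F] K') (x : K') :
    σ.liftNormal (AlgebraicClosure F) (x : AlgebraicClosure F) = ((σ x : K') : AlgebraicClosure F) :=
  AlgEquiv.liftNormal_commutes σ (AlgebraicClosure F) x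

end Descent

/-! ## §2 From a `q^ℤ`-uniformisation of `E(F̄)` to one of `E(K')`, for every `K' ⊆ F̄` -/

section Engine

variable {F : Type u} [Field F] [CharZero F] (W : WeierstrassCurve F) (q : F)
  (φ : Additive (AlgebraicClosure F)ˣ →+ (W.baseChange (AlgebraicClosure F)).toAffine.Point)
  (hker : ∀ u : (AlgebraicClosure F)ˣ, φ (Additive.ofMul u) = 0 ↔
      ∃ n : ℤ, (u : AlgebraicClosure F) = algebraMap F (AlgebraicClosure F) q ^ n)
  (hequiv : ∀ (τ : AlgebraicClosure F ≃ₐ[F] AlgebraicClosure F) (u : (AlgebraicClosure F)ˣ),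
      τ • φ (Additive.ofMul u) =
        φ (Additive.ofMul (Units.map (τ : AlgebraicClosure F →* AlgebraicClosure F) u)))
  (hdesc : ∀ (L : IntermediateField F (AlgebraicClosure F))
      (P : (W.baseChange (AlgebraicClosure F)).toAffine.Point),
      (∀ τ : AlgebraicClosure F ≃ₐ[F] AlgebraicClosure F, τ ∈ L.fixingSubgroup → τ • P = P) →
      ∃ u : (AlgebraicClosure F)ˣ, (u : AlgebraicClosure F) ∈ L ∧ φ (Additive.ofMul u) = P)

include hker hequiv hdesc in
/-- **`L^*/q^ℤ ⥲ E_q(L)` in rational-point currency** (Silverman ATAEC Thm. V.3.1 (d): "for any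
algebraic extension `L/K`, `φ` induces an isomorphism `φ : L^*/q^ℤ ⥲ E_q(L)`"). Given a
homomorphism `φ : F̄ˣ → E(F̄)` with kernel `q^ℤ` (`q ∈ F`), `Aut(F̄/F)`-equivariant, whose
`Gal(F̄/L)`-fixed values come from `Lˣ` (the clauses of the tree's `TateCurve.uniformization`), and an
intermediate field `K'`, there is a homomorphism `g : K'ˣ → E(K')` (points of `W.baseChange K'`) with
`g(u) ↦ φ(u)` under `E(K') ↪ E(F̄)`, surjective, with kernel `q^ℤ`, and `g(σu) = σ·g(u)` for every
`σ ∈ Aut(K'/F)`. Proof: `φ(u)`, `u ∈ K'`, is `Gal(F̄/K')`-fixed, hence a `K'`-point (§1); additivity,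
kernel and equivariance are read off through the injection `E(K') ↪ E(F̄)`, lifting `σ` to `F̄`.
[cite: SilvermanATAEC1994, Thm. V.3.1 (d) (PDF pp. 395, 399)] -/
theorem exists_uniformizer_intermediateField (K' : IntermediateField F (AlgebraicClosure F)) :
    ∃ g : Additive (↥K')ˣ →+ (W.baseChange K').toAffine.Point,
      (∀ u : (↥K')ˣ, Affine.Point.map (W' := W) (IntermediateField.val K') (g (Additive.ofMul u)) =
          φ (Additive.ofMul (Units.map (IntermediateField.val K' : K' →* AlgebraicClosure F) u))) ∧
      Function.Surjective g ∧
      (∀ u : (↥K')ˣ, g (Additive.ofMul u) = 0 ↔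
          ∃ n : ℤ, ((u : K') : K') = algebraMap F K' q ^ n) ∧
      (∀ (σ : K' ≃ₐ[F] K') (u : (↥K')ˣ),
          g (Additive.ofMul (Units.map (σ : K' →* K') u)) =
            Affine.Point.map (W' := W) (σ : K' →ₐ[F] K') (g (Additive.ofMul u))) := by
  -- notation
  set ι : (↥K')ˣ →* (AlgebraicClosure F)ˣ :=
    Units.map (IntermediateField.val K' : K' →* AlgebraicClosure F) with hι
  have hιval : ∀ u : (↥K')ˣ, ((ι u : (AlgebraicClosure F)ˣ) : AlgebraicClosure F) =
      ((u : K') : AlgebraicClosure F) := fun u => rfl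
  have hinj : Function.Injective (Affine.Point.map (W' := W) (IntermediateField.val K')) :=
    Affine.Point.map_injective (IntermediateField.val K')
  -- Step 1: `φ(u)` is fixed by `Gal(F̄/K')` for `u ∈ K'`
  have hfixφ : ∀ (u : (↥K')ˣ) (τ : AlgebraicClosure F ≃ₐ[F] AlgebraicClosure F),
      τ ∈ K'.fixingSubgroup → τ • φ (Additive.ofMul (ι u)) = φ (Additive.ofMul (ι u)) := by
    intro u τ hτ
    rw [hequiv]
    congr 2
    ext
    rw [Units.coe_map, hιval]
    exact (IntermediateField.mem_fixingSubgroup_iff _ _).mp hτ _ (u : K').2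
  -- Step 2: the descended points
  choose g₀ hg₀ using fun u : (↥K')ˣ =>
    exists_map_val_eq_of_forall_smul_eq W K' (φ (Additive.ofMul (ι u))) (hfixφ u)
  -- Step 3: additivity
  have hmul : ∀ u v : (↥K')ˣ, g₀ (u * v) = g₀ u + g₀ v := by
    intro u v
    apply hinj
    rw [map_add, hg₀, hg₀, hg₀, map_mul, ofMul_mul, map_add]
  let g : Additive (↥K')ˣ →+ (W.baseChange K').toAffine.Point :=
    AddMonoidHom.mk' (fun a => g₀ (Additive.toMul a)) (by
      intro a b
      simp only [toMul_add, hmul])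
  have hg : ∀ u : (↥K')ˣ, g (Additive.ofMul u) = g₀ u := fun u => rfl
  refine ⟨g, fun u => by rw [hg, hg₀], ?_, ?_, ?_⟩
  · -- surjective
    intro P₀
    obtain ⟨u, huK, hu⟩ := hdesc K' (Affine.Point.map (W' := W) (IntermediateField.val K') P₀)
      (fun τ hτ => smul_map_val_of_mem_fixingSubgroup W K' P₀ τ hτ)
    have hu0 : (⟨(u : AlgebraicClosure F), huK⟩ : K') ≠ 0 := by
      intro h
      apply u.ne_zero
      simpa using congrArg (fun z : K' => (z : AlgebraicClosure F)) h
    refine ⟨Additive.ofMul (Units.mk0 _ hu0), ?_⟩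
    rw [hg]
    apply hinj
    rw [hg₀, ← hu]
    congr 2
    ext
    rfl
  · -- kernel
    intro u
    rw [hg]
    constructor
    · intro h0
      have h1 : φ (Additive.ofMul (ι u)) = 0 := by rw [← hg₀, h0, map_zero]
      obtain ⟨n, hn⟩ := (hker (ι u)).mp h1
      refine ⟨n, ?_⟩
      apply (IntermediateField.val K').injective
      rw [map_zpow₀]
      change ((u : K') : AlgebraicClosure F) = (algebraMap F (AlgebraicClosure F) q) ^ n
      rw [← hιval, hn]
    · rintro ⟨n, hn⟩
      apply hinj
      rw [hg₀, map_zero]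
      apply (hker (ι u)).mpr
      refine ⟨n, ?_⟩
      rw [hιval, hn]
      change (IntermediateField.val K') (algebraMap F K' q ^ n) = _
      rw [map_zpow₀, AlgHom.commutes]
  · -- equivariance
    intro σ u
    rw [hg, hg]
    apply hinj
    rw [hg₀, map_val_map_algEquiv, hg₀, hequiv]
    congr 2
    ext
    change (IntermediateField.val K') ((Units.map (σ : K' →* K') u : (↥K')ˣ) : K') =
      ((σ.liftNormal (AlgebraicClosure F) : AlgebraicClosure F →* AlgebraicClosure F)
        ((ι u : (AlgebraicClosure F)ˣ) : AlgebraicClosure F))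
    rw [Units.coe_map, hιval, MonoidHom.coe_coe, MonoidHom.coe_coe]
    exact (liftNormal_apply_coe K' σ (u : K')).symm

end Engine

/-! ## §3 Transport along an `F`-isomorphism `C • E = X` -/

section Transport

variable {F : Type u} [Field F] (E : WeierstrassCurve F) (C : VariableChange F)
  (K' : IntermediateField F (AlgebraicClosure F)) (q : F)

/-- A uniformisation `K'ˣ/q^ℤ ≅ (C • E)(K')` compatible with `Aut(K'/F)` transports to one of
`E(K')` along the change of variables `C` defined over `F` (the tree's
`VariableChange.pointEquivBaseChange`, an isomorphism of Galois modules: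
`pointEquivBaseChange_symm_map`). Silverman AEC III.3.1 (b) with VIII.§1.
[cite: SilvermanAEC2009, III.3.1(b)] -/
theorem exists_uniformizer_of_variableChange
    (g : Additive (↥K')ˣ →+ ((C • E).baseChange K').toAffine.Point)
    (hgs : Function.Surjective g)
    (hgk : ∀ u : (↥K')ˣ, g (Additive.ofMul u) = 0 ↔
      ∃ n : ℤ, ((u : K') : K') = algebraMap F K' q ^ n)
    (hge : ∀ (σ : K' ≃ₐ[F] K') (u : (↥K')ˣ),
      g (Additive.ofMul (Units.map (σ : K' →* K') u)) =
        Affine.Point.map (W' := C • E) (σ : K' →ₐ[F] K') (g (Additive.ofMul u))) :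
    ∃ f : Additive (↥K')ˣ →+ (E.baseChange K').toAffine.Point,
      Function.Surjective f ∧
      (∀ u : (↥K')ˣ, f (Additive.ofMul u) = 0 ↔
          ∃ n : ℤ, ((u : K') : K') = algebraMap F K' q ^ n) ∧
      (∀ (σ : K' ≃ₐ[F] K') (u : (↥K')ˣ),
          f (Additive.ofMul (Units.map (σ : K' →* K') u)) =
            Affine.Point.map (W' := E) (σ : K' →ₐ[F] K') (f (Additive.ofMul u))) := by
  set e := VariableChange.pointEquivBaseChange E C K' with he
  refine ⟨e.symm.toAddMonoidHom.comp g, e.symm.surjective.comp hgs, fun u => ?_, fun σ u => ?_⟩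
  · rw [← hgk u]
    exact e.symm.map_eq_zero_iff (x := g (Additive.ofMul u))
  · change e.symm (g _) = Affine.Point.map (W' := E) (σ : K' →ₐ[F] K') (e.symm (g _))
    rw [hge, VariableChange.pointEquivBaseChange_symm_map]

end Transport

/-! ## §4 Over a non-archimedean local field: Tate's uniformisation in Kramer–Tunnell currency -/

section Local

variable (F : Type) [Field F] [ValuativeRel F] [TopologicalSpace F] [IsNonarchimedeanLocalField F]

/-- The compatibility `‖x‖ ≤ 1 ↔ x ∈ 𝒪[F]` between the valuation norm of `F` (the tree's
`IsNonarchimedeanLocalField.nontriviallyNormedField F`) and its valuation ring, in the form the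
Tate-curve API asks for (`R = 𝒪[F]`). Private helper. [folklore] -/
private theorem norm_le_one_iff_mem_range :
    letI := nontriviallyNormedField F
    ∀ x : F, ‖x‖ ≤ 1 ↔ x ∈ Set.range (algebraMap 𝒪[F] F) := by
  letI := nontriviallyNormedField F
  intro x
  rw [norm_le_one_iff F x]
  constructor
  · intro hx; exact ⟨⟨x, hx⟩, rfl⟩
  · rintro ⟨y, rfl⟩; exact y.2

variable {F}

omit [ValuativeRel F] [TopologicalSpace F] [IsNonarchimedeanLocalField F] in
/-- `∏ (1 - q^{n+1})^{12}` is multipliable for `‖q‖ < 1` (same proof as the tree's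
`multipliable_tateDelta_factor`, exponent `12` instead of `24`). Private helper. [folklore] -/
private theorem multipliable_tateDelta_factor_twelve {K : Type*} [NontriviallyNormedField K] [CompleteSpace K]
    [IsUltrametricDist K] {q : K} (hq : ‖q‖ < 1) :
    Multipliable fun n : ℕ ↦ (1 - q ^ (n + 1)) ^ 12 := by
  have heq : (fun n : ℕ ↦ (1 - q ^ (n + 1)) ^ 12) =
      fun n : ℕ ↦ 1 + ((1 - q ^ (n + 1)) ^ 12 - 1) := by
    funext n; ring
  rw [heq]
  refine multipliable_one_add_of_summable ?_
  refine Summable.of_nonneg_of_le (fun _ ↦ norm_nonneg _) (fun n ↦ ?_)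
    ((summable_geometric_of_lt_one (norm_nonneg q) hq).mul_right ‖q‖)
  have h1 : ‖1 - q ^ (n + 1)‖ ≤ 1 := by
    rw [sub_eq_add_neg]
    refine (IsUltrametricDist.norm_add_le_max _ _).trans (max_le (by rw [norm_one]) ?_)
    rw [norm_neg, norm_pow]; exact pow_le_one₀ (norm_nonneg _) hq.le
  calc ‖(1 - q ^ (n + 1)) ^ 12 - 1‖ = ‖(1 - q ^ (n + 1)) ^ 12 - 1 ^ 12‖ := by rw [one_pow]
    _ ≤ ‖(1 - q ^ (n + 1)) - 1‖ := norm_pow_sub_pow_le h1 (by rw [norm_one]) 12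
    _ = ‖q‖ ^ n * ‖q‖ := by rw [sub_sub_cancel_left, norm_neg, norm_pow, pow_succ]

omit [ValuativeRel F] [TopologicalSpace F] [IsNonarchimedeanLocalField F] in
/-- **"`Δq^{-1}` is a square"** (Kramer p. 123, last sentence of the proof of Prop. 1): the
discriminant of the Tate curve is `Δ(E_q) = q ∏ (1 - q^n)^{24} = q · (∏ (1 - q^n)^{12})²`
(Silverman ATAEC V.3.1 (b), the tree's `tateCurve_discr`).
[cite: Kramer1981, §2 proof of Prop. 1 (p. 123), "Δq⁻¹ is a square in F"] -/
theorem tateCurve_Δ_eq_mul_sq {K : Type*} [NontriviallyNormedField K] [CompleteSpace K]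
    [IsUltrametricDist K] [CharZero K] {q : K} (hq : ‖q‖ < 1) :
    (tateCurve q).Δ = q * (∏' n : ℕ, (1 - q ^ (n + 1)) ^ 12) ^ 2 := by
  rw [tateCurve_discr hq, tateDelta, ← (multipliable_tateDelta_factor_twelve hq).tprod_pow 2]
  congr 1
  refine tprod_congr fun n => ?_
  rw [← pow_mul]

variable [CharZero F]

/-- **Tate's uniformisation of a curve with split multiplicative reduction, in Kramer–Tunnell
currency** ("If `E` is a Tate curve over `F`, then there is an element `q` in `F` with
`Δ = q ∏ (1 - q^n)^{24}` such that `E` is isomorphic to `G_m/q^ℤ`", Kramer p. 123, from Tate /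
Silverman ATAEC V.3.1, V.5.3 — the tree's `exists_tateParameter_of_hasSplitMultiplicativeReduction'`
and `uniformization_holds`). For `F` a non-archimedean local field of characteristic `0` and `E/F`
elliptic whose minimal model (Mathlib `E.minimal 𝒪[F]`) has split multiplicative reduction: there is
`q ∈ F`, `q ≠ 0`, `v(q) < 1`, no power `q^n` (`n ≠ 0`) equal to `1`, with `Δ_min = q·c²` for some
`c ∈ F`, and for EVERY intermediate field `K'` of `F̄/F` a surjective homomorphism
`f : K'ˣ → E(K')` with kernel `q^ℤ` and `f(σu) = σ·f(u)` for all `σ ∈ Aut(K'/F)`.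
[cite: Kramer1981, §2 (p. 123), "E is isomorphic to G_m/q^ℤ"]
[cite: SilvermanATAEC1994, Thm. V.3.1 (c),(d) and Thm. V.5.3] -/
theorem exists_splitMultiplicative_uniformizer (E : WeierstrassCurve F) [E.IsElliptic]
    (hsplit : (E.minimal 𝒪[F]).HasSplitMultiplicativeReduction 𝒪[F]) :
    ∃ q : F, q ≠ 0 ∧ valuation F q < 1 ∧ (∀ n : ℤ, q ^ n = 1 → n = 0) ∧
      (∃ c : F, (E.minimal 𝒪[F]).Δ = q * c ^ 2) ∧
      ∀ K' : IntermediateField F (AlgebraicClosure F),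
        ∃ f : Additive (↥K')ˣ →+ (E.baseChange K').toAffine.Point,
          Function.Surjective f ∧
          (∀ u : (↥K')ˣ, f (Additive.ofMul u) = 0 ↔
              ∃ n : ℤ, ((u : K') : K') = algebraMap F K' q ^ n) ∧
          (∀ (σ : K' ≃ₐ[F] K') (u : (↥K')ˣ),
              f (Additive.ofMul (Units.map (σ : K' →* K') u)) =
                Affine.Point.map (W' := E) (σ : K' →ₐ[F] K') (f (Additive.ofMul u))) := by
  letI := nontriviallyNormedField F
  obtain ⟨q, hq0, hq, -, -, C, hC⟩ :=
    exists_tateParameter_of_hasSplitMultiplicativeReduction' 𝒪[F] (norm_le_one_iff_mem_range F) E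
      ⟨(E.exists_isMinimal 𝒪[F]).choose, hsplit⟩
  obtain ⟨φ, -, hφk, hφe, hφd⟩ := uniformization_holds q hq0 hq
  refine ⟨q, hq0, (norm_lt_one_iff F q).mp hq, fun n hn => ?_, ?_, fun K' => ?_⟩
  · have h := congrArg (fun z : F => ‖z‖) hn
    simp only [norm_zpow, norm_one] at h
    have h' : ‖q‖ ^ n = ‖q‖ ^ (0 : ℤ) := by rw [h, zpow_zero]
    exact zpow_right_injective₀ (norm_pos_iff.mpr hq0) hq.ne h'
  · -- `Δ q⁻¹` is a square in `F` (Kramer p. 123, last sentence of the proof of Prop. 1)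
    have hmin : E.minimal 𝒪[F] = (E.exists_isMinimal 𝒪[F]).choose • C⁻¹ • tateCurve q := by
      rw [← hC, inv_smul_smul]; rfl
    refine ⟨((E.exists_isMinimal 𝒪[F]).choose.u⁻¹ : Fˣ) ^ 6 * ((C⁻¹.u⁻¹ : Fˣ) : F) ^ 6 *
      ∏' n : ℕ, (1 - q ^ (n + 1)) ^ 12, ?_⟩
    rw [hmin, variableChange_Δ, variableChange_Δ, tateCurve_Δ_eq_mul_sq hq]
    ring
  · obtain ⟨g, -, hgs, hgk, hge⟩ := exists_uniformizer_intermediateField (tateCurve q) q φ hφk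
      (fun τ u => hφe ((absoluteGaloisGroup.toAlgEquiv F).symm τ) u)
      (fun L P hP => hφd L P fun σ hσ => hP (absoluteGaloisGroup.toAlgEquiv F σ) hσ) K'
    have key : ∀ X : WeierstrassCurve F, C • E = X →
        ∀ g : Additive (↥K')ˣ →+ (X.baseChange K').toAffine.Point,
          Function.Surjective g →
          (∀ u : (↥K')ˣ, g (Additive.ofMul u) = 0 ↔
            ∃ n : ℤ, ((u : K') : K') = algebraMap F K' q ^ n) →
          (∀ (σ : K' ≃ₐ[F] K') (u : (↥K')ˣ),
            g (Additive.ofMul (Units.map (σ : K' →* K') u)) =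
              Affine.Point.map (W' := X) (σ : K' →ₐ[F] K') (g (Additive.ofMul u))) →
          ∃ f : Additive (↥K')ˣ →+ (E.baseChange K').toAffine.Point,
            Function.Surjective f ∧
            (∀ u : (↥K')ˣ, f (Additive.ofMul u) = 0 ↔
                ∃ n : ℤ, ((u : K') : K') = algebraMap F K' q ^ n) ∧
            (∀ (σ : K' ≃ₐ[F] K') (u : (↥K')ˣ),
                f (Additive.ofMul (Units.map (σ : K' →* K') u)) =
                  Affine.Point.map (W' := E) (σ : K' →ₐ[F] K') (f (Additive.ofMul u))) := by
      rintro X rfl g hgs hgk hge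
      exact exists_uniformizer_of_variableChange E C K' q g hgs hgk hge
    exact key (tateCurve q) hC g hgs hgk hge

end Local


/-! ## §5 The quadratic extension `K' = F(x)`, `x² = d`: `σ² = 1`, `u·σu = s² - d t²` -/

section Quadratic

variable {F : Type u} [Field F] {K' : IntermediateField F (AlgebraicClosure F)}

/-- The non-trivial automorphism `σ` of the quadratic extension `K' = F(x)` is an involution
(`σx = -x`, tree `algEquiv_apply_eq_neg`). [cite: Kramer1981, §2 (pp. 123–124), Gal(K/F) = ⟨σ⟩ (unfolding)] -/
theorem algEquiv_mul_self_eq_one (h2 : Module.finrank F K' = 2) {d : F} (hd : ¬ IsSquare d)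
    {x : K'} (hx : x ^ 2 = algebraMap F K' d) {σ : K' ≃ₐ[F] K'} (hσ : σ ≠ 1) : σ * σ = 1 := by
  apply AlgEquiv.ext
  intro y
  obtain ⟨a, b, rfl⟩ := exists_eq_add_mul h2 hd hx y
  have hσx := algEquiv_apply_eq_neg h2 hd hx hσ
  rw [AlgEquiv.mul_apply, AlgEquiv.one_apply]
  simp only [map_add, map_mul, map_neg, AlgEquiv.commutes, hσx, mul_neg, neg_neg]

/-- `σ (σ y) = y` (pointwise form of `σ² = 1`). [cite: Kramer1981, §2 (pp. 123–124), Gal(K/F) = ⟨σ⟩ (unfolding)] -/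
theorem algEquiv_algEquiv_apply (h2 : Module.finrank F K' = 2) {d : F} (hd : ¬ IsSquare d)
    {x : K'} (hx : x ^ 2 = algebraMap F K' d) {σ : K' ≃ₐ[F] K'} (hσ : σ ≠ 1) (y : K') :
    σ (σ y) = y := by
  rw [← AlgEquiv.mul_apply, algEquiv_mul_self_eq_one h2 hd hx hσ, AlgEquiv.one_apply]

/-- **The norm form**: `(s + tx)·σ(s + tx) = s² - d t²` — Kramer's "field-theoretic norm" on
`K = F(d^{1/2})` (p. 123), the form defining the tree's `quadraticNormSubgroup F d`.
[cite: Kramer1981, §2 proof of Prop. 1 (p. 123), "field-theoretic norm"] -/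
theorem add_mul_mul_algEquiv (h2 : Module.finrank F K' = 2) {d : F} (hd : ¬ IsSquare d)
    {x : K'} (hx : x ^ 2 = algebraMap F K' d) {σ : K' ≃ₐ[F] K'} (hσ : σ ≠ 1) (s t : F) :
    (algebraMap F K' s + algebraMap F K' t * x) * σ (algebraMap F K' s + algebraMap F K' t * x) =
      algebraMap F K' (s ^ 2 - d * t ^ 2) := by
  have hσx := algEquiv_apply_eq_neg h2 hd hx hσ
  rw [map_add, map_mul, AlgEquiv.commutes, AlgEquiv.commutes, hσx, map_sub, map_pow, map_mul,
    map_pow, ← hx]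
  ring

/-- Every `u ∈ K'` has `u·σu = s² - d t²` for some `s, t ∈ F` (`u = s + tx`, tree
`exists_eq_add_mul`). [cite: Kramer1981, §2 proof of Prop. 1 (p. 123), "field-theoretic norm"] -/
theorem exists_mul_algEquiv_eq (h2 : Module.finrank F K' = 2) {d : F} (hd : ¬ IsSquare d)
    {x : K'} (hx : x ^ 2 = algebraMap F K' d) {σ : K' ≃ₐ[F] K'} (hσ : σ ≠ 1) (u : K') :
    ∃ s t : F, u * σ u = algebraMap F K' (s ^ 2 - d * t ^ 2) := by
  obtain ⟨s, t, rfl⟩ := exists_eq_add_mul h2 hd hx u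
  exact ⟨s, t, add_mul_mul_algEquiv h2 hd hx hσ s t⟩

end Quadratic

/-! ## §6 "The norm mapping on `E` corresponds to field-theoretic norm modulo `q^ℤ`" -/

section Uniformized

variable {F : Type u} [Field F] [CharZero F] {K' : IntermediateField F (AlgebraicClosure F)}
  (h2 : Module.finrank F K' = 2) {σ : K' ≃ₐ[F] K'} (hσ : σ ≠ 1) {d : F} (hd : ¬ IsSquare d)
  {x : K'} (hx : x ^ 2 = algebraMap F K' d)
  (E : WeierstrassCurve F) {q : F} (hq0 : q ≠ 0) (hq1 : ∀ n : ℤ, q ^ n = 1 → n = 0)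
  (f : Additive (↥K')ˣ →+ (E.baseChange K').toAffine.Point)
  (hfs : Function.Surjective f)
  (hfk : ∀ u : (↥K')ˣ, f (Additive.ofMul u) = 0 ↔
      ∃ n : ℤ, ((u : K') : K') = algebraMap F K' q ^ n)
  (hfe : ∀ (τ : K' ≃ₐ[F] K') (u : (↥K')ˣ),
      f (Additive.ofMul (Units.map (τ : K' →* K') u)) =
        Affine.Point.map (W' := E) (τ : K' →ₐ[F] K') (f (Additive.ofMul u)))

include h2 hσ hd hx hq1 hfk hfe in
/-- If `f(u)` is `σ`-fixed then `u ∈ F`: `f(σu/u) = O` gives `σu = q^n u`; applying `σ` again,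
`q^{2n} = 1`, so `n = 0` (`q` is not a root of unity) and `σu = u`, whence `u ∈ F` (tree
`exists_eq_algebraMap_of_fixed`). This is the step `(L^*/q^ℤ)^σ = F^*/q^ℤ` behind
"`E(F)/N{E(K)} = F*/(NK*)q^ℤ`". [cite: Kramer1981, §2 proof of Prop. 1 (p. 123)] -/
theorem exists_eq_algebraMap_of_map_eq (u : (↥K')ˣ)
    (hu : Affine.Point.map (W' := E) (σ : K' →ₐ[F] K') (f (Additive.ofMul u)) =
      f (Additive.ofMul u)) :
    ∃ a : F, ((u : K') : K') = algebraMap F K' a := by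
  -- `f (σu / u) = 0`, so `σ u = q^n u`
  have h0 : f (Additive.ofMul (Units.map (σ : K' →* K') u * u⁻¹)) = 0 := by
    rw [ofMul_mul, ofMul_inv, map_add, map_neg, hfe, hu, add_neg_cancel]
  obtain ⟨n, hn⟩ := (hfk _).mp h0
  have hσu : σ (u : K') = algebraMap F K' q ^ n * (u : K') := by
    have : ((Units.map (σ : K' →* K') u * u⁻¹ : (↥K')ˣ) : K') * (u : K') = σ (u : K') := by
      rw [Units.val_mul, Units.coe_map, MonoidHom.coe_coe, Units.inv_mul_cancel_right]
    rw [← this, hn]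
  -- apply `σ` again: `u = q^{2n} u`, so `q^{2n} = 1`, `n = 0`
  have hu0 : ((u : K') : K') ≠ 0 := u.ne_zero
  have hsq : (algebraMap F K' q ^ n) ^ 2 = 1 := by
    have e := congrArg σ hσu
    rw [algEquiv_algEquiv_apply h2 hd hx hσ, map_mul, map_zpow₀, AlgEquiv.commutes, hσu,
      ← mul_assoc, ← sq] at e
    -- e : u = (q^n)^2 * u
    have e' : ((algebraMap F K' q ^ n) ^ 2 - 1) * (u : K') = 0 := by
      rw [sub_mul, one_mul, ← e, sub_self]
    rcases mul_eq_zero.mp e' with h | h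
    · exact sub_eq_zero.mp h
    · exact absurd h hu0
  have hn0 : n = 0 := by
    have hq2 : q ^ (2 * n) = 1 := by
      apply (algebraMap F K').injective
      rw [map_zpow₀, map_one, mul_comm, zpow_mul, ← hsq, zpow_ofNat]
    have := hq1 (2 * n) hq2
    omega
  rw [hn0, zpow_zero, one_mul] at hσu
  exact exists_eq_algebraMap_of_fixed h2 hd hx hσ hσu

include h2 hσ hd hx hq1 hfs hfk hfe in
/-- **`E(K')^σ = f(Fˣ)`**: the `σ`-fixed points (the numerator `E(F)` of Kramer's `E(F)/N{E(K)}`,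
typed as `KramerTunnell1982.fixedSubgroup`) are exactly the images of the elements of `Fˣ`.
[cite: Kramer1981, §2 proof of Prop. 1 (p. 123), "E(F)/N{E(K)} = F*/(NK*)q^ℤ"] -/
theorem mem_fixedSubgroup_iff_exists (P : (E.baseChange K').toAffine.Point) :
    P ∈ fixedSubgroup E K' σ ↔
      ∃ a : Fˣ, f (Additive.ofMul (Units.map (algebraMap F K' : F →* K') a)) = P := by
  rw [mem_fixedSubgroup_iff]
  constructor
  · intro hP
    obtain ⟨w, rfl⟩ := hfs P
    obtain ⟨u, rfl⟩ : ∃ u, Additive.ofMul u = w := ⟨Additive.toMul w, rfl⟩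
    obtain ⟨a, ha⟩ := exists_eq_algebraMap_of_map_eq h2 hσ hd hx E hq1 f hfk hfe u hP
    have ha0 : a ≠ 0 := by
      rintro rfl
      rw [map_zero] at ha
      exact u.ne_zero ha
    refine ⟨Units.mk0 a ha0, ?_⟩
    congr 2
    ext
    rw [Units.coe_map, MonoidHom.coe_coe, Units.val_mk0, ha]
  · rintro ⟨a, rfl⟩
    rw [← hfe]
    congr 2
    ext
    rw [Units.coe_map, Units.coe_map, MonoidHom.coe_coe, MonoidHom.coe_coe, AlgEquiv.commutes]

include h2 hσ hd hx hfs hfe in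
omit [CharZero F] in
/-- **`N E(K') = f(N_{K'/F}K'ˣ)`**: "the norm mapping on `E` corresponds to field-theoretic norm
modulo `q^ℤ`" (Kramer p. 123) — the norms `P + σP` (the tree's `KramerTunnell1982.normSubgroup`) are
exactly the images of the non-zero `s² - d t²`, i.e. of the tree's `quadraticNormSubgroup F d`.
[cite: Kramer1981, §2 proof of Prop. 1 (p. 123), "the norm mapping on E corresponds to field-theoretic norm modulo q^ℤ"] -/
theorem mem_normSubgroup_iff_exists (P : (E.baseChange K').toAffine.Point) :
    P ∈ normSubgroup E K' σ ↔
      ∃ a : Fˣ, a ∈ quadraticNormSubgroup F d ∧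
        f (Additive.ofMul (Units.map (algebraMap F K' : F →* K') a)) = P := by
  rw [mem_normSubgroup_iff]
  constructor
  · rintro ⟨Q, rfl⟩
    obtain ⟨w, rfl⟩ := hfs Q
    obtain ⟨u, rfl⟩ : ∃ u, Additive.ofMul u = w := ⟨Additive.toMul w, rfl⟩
    obtain ⟨s, t, hst⟩ := exists_mul_algEquiv_eq h2 hd hx hσ (u : K')
    have ha0 : s ^ 2 - d * t ^ 2 ≠ 0 := by
      intro h
      rw [h, map_zero] at hst
      rcases mul_eq_zero.mp hst with h' | h'
      · exact u.ne_zero h'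
      · exact u.ne_zero (by simpa using congrArg σ.symm h')
    refine ⟨Units.mk0 _ ha0, ⟨s, t, by rw [Units.val_mk0]⟩, ?_⟩
    rw [← hfe, ← map_add, ← ofMul_mul]
    congr 2
    ext
    rw [Units.coe_map, MonoidHom.coe_coe, Units.val_mk0, Units.val_mul, Units.coe_map,
      MonoidHom.coe_coe, ← hst]
  · rintro ⟨a, ⟨s, t, hst⟩, rfl⟩
    -- `a = s² - d t² = u σu` with `u = s + t x ≠ 0`
    set u : K' := algebraMap F K' s + algebraMap F K' t * x with hu
    have huσ : u * σ u = algebraMap F K' (a : F) := by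
      rw [hu, add_mul_mul_algEquiv h2 hd hx hσ s t, hst]
    have hu0 : u ≠ 0 := by
      intro h
      rw [h, zero_mul, eq_comm, map_eq_zero_iff _ (algebraMap F K').injective] at huσ
      exact a.ne_zero huσ
    refine ⟨f (Additive.ofMul (Units.mk0 u hu0)), ?_⟩
    rw [← hfe, ← map_add, ← ofMul_mul]
    congr 2
    ext
    rw [Units.val_mul, Units.coe_map, MonoidHom.coe_coe, Units.val_mk0, Units.coe_map,
      MonoidHom.coe_coe, huσ]

end Uniformized

/-! ## §7 "Thus `E(F)/N{E(K)} = F*/(NK*)q^ℤ`": the index -/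

section Index

/-- **Subgroups between an index-`2` subgroup and the whole group** (additive form): if
`A ≤ M ≤ A + ℤg` with `(G : A) = 2` and `g ∈ M`, then `(G : M) = 2` if `g ∈ A` and `(G : M) = 1`
if `g ∉ A` — "by local class field theory, `i(K/F)` therefore is at most `1`, and `i(K/F) = 1`
precisely when `q ∈ NK*`" (Kramer p. 123): the group theory of that sentence.
[cite: Kramer1981, §2 proof of Prop. 1 (p. 123) — "i(K/F) therefore is at most 1 … = 1 precisely when q ∈ NK*"] -/
theorem index_eq_of_index_eq_two {G : Type*} [AddCommGroup G] {A M : AddSubgroup G}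
    (hA : A.index = 2) (hAM : A ≤ M) {g : G} (hg : g ∈ M)
    (hM : M ≤ A ⊔ AddSubgroup.zmultiples g) :
    (g ∈ A → M.index = 2) ∧ (g ∉ A → M.index = 1) := by
  constructor
  · intro hgA
    have hMA : M = A := by
      refine le_antisymm (hM.trans (sup_le le_rfl ?_)) hAM
      exact (AddSubgroup.zmultiples_le_of_mem hgA)
    rw [hMA, hA]
  · intro hgA
    have hmul := AddSubgroup.relIndex_mul_index hAM
    rw [hA] at hmul
    have hdvd : M.index ∣ 2 := Dvd.intro_left _ hmul
    rcases (Nat.dvd_prime Nat.prime_two).mp hdvd with h1 | h2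
    · exact h1
    · exfalso
      rw [h2] at hmul
      have hrel : A.relIndex M = 1 := by omega
      rw [AddSubgroup.relIndex_eq_one] at hrel
      exact hgA (hrel hg)

variable {F : Type u} [Field F] [CharZero F] {K' : IntermediateField F (AlgebraicClosure F)}
  (h2 : Module.finrank F K' = 2) {σ : K' ≃ₐ[F] K'} (hσ : σ ≠ 1) {d : F} (hd : ¬ IsSquare d)
  {x : K'} (hx : x ^ 2 = algebraMap F K' d)
  (E : WeierstrassCurve F) {q : F} (hq0 : q ≠ 0) (hq1 : ∀ n : ℤ, q ^ n = 1 → n = 0)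
  (f : Additive (↥K')ˣ →+ (E.baseChange K').toAffine.Point)
  (hfs : Function.Surjective f)
  (hfk : ∀ u : (↥K')ˣ, f (Additive.ofMul u) = 0 ↔
      ∃ n : ℤ, ((u : K') : K') = algebraMap F K' q ^ n)
  (hfe : ∀ (τ : K' ≃ₐ[F] K') (u : (↥K')ˣ),
      f (Additive.ofMul (Units.map (τ : K' →* K') u)) =
        Affine.Point.map (W' := E) (τ : K' →ₐ[F] K') (f (Additive.ofMul u)))

include hq0 hfk in
omit [CharZero F] in
/-- **The kernel on `Fˣ`**: `f(a) = O` for `a ∈ Fˣ` iff `a ∈ q^ℤ` (the kernel `q^ℤ` of the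
uniformisation, read on `F`). [cite: Kramer1981, §2 proof of Prop. 1 (p. 123), "E(F)/N{E(K)} = F*/(NK*)q^ℤ"] -/
theorem map_algebraMap_eq_zero_iff (a : Fˣ) :
    f (Additive.ofMul (Units.map (algebraMap F K' : F →* K') a)) = 0 ↔
      ∃ n : ℤ, a = Units.mk0 q hq0 ^ n := by
  rw [hfk]
  refine exists_congr fun n => ?_
  rw [Units.coe_map, MonoidHom.coe_coe, Units.ext_iff, Units.val_zpow_eq_zpow_val, Units.val_mk0,
    ← map_zpow₀]
  exact (algebraMap F K').injective.eq_iff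

include h2 hσ hd hx hq0 hq1 hfs hfk hfe in
/-- **`#(E(F)/N E(K')) = (Fˣ : q^ℤ · N_{K'/F} K'ˣ)`** — Kramer's "Thus `E(F)/N{E(K)} =
F*/(NK*)q^ℤ`" (p. 123): with `(Fˣ : N_{K'/F} K'ˣ) = 2` (local class field theory) the relative
index of the norm subgroup in the fixed subgroup is `2` if `q` is a norm and `1` if it is not.
[cite: Kramer1981, §2 Prop. 1 and its proof (p. 123)] -/
theorem relIndex_normSubgroup_fixedSubgroup_of_index_eq_two
    (hNm : (quadraticNormSubgroup F d).index = 2) :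
    (Units.mk0 q hq0 ∈ quadraticNormSubgroup F d →
        (normSubgroup E K' σ).relIndex (fixedSubgroup E K' σ) = 2) ∧
      (Units.mk0 q hq0 ∉ quadraticNormSubgroup F d →
        (normSubgroup E K' σ).relIndex (fixedSubgroup E K' σ) = 1) := by
  -- the homomorphism `h : Fˣ → E(K')`, `a ↦ f(a)`
  set h : Additive Fˣ →+ (E.baseChange K').toAffine.Point :=
    f.comp (MonoidHom.toAdditive (Units.map (algebraMap F K' : F →* K'))) with hh
  have happ : ∀ a : Fˣ, h (Additive.ofMul a) =
      f (Additive.ofMul (Units.map (algebraMap F K' : F →* K') a)) := fun a => rfl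
  -- its image is the fixed subgroup
  have hΦ : ∀ w : Additive Fˣ, h w ∈ fixedSubgroup E K' σ := by
    intro w
    rw [mem_fixedSubgroup_iff_exists h2 hσ hd hx E hq1 f hfs hfk hfe]
    exact ⟨Additive.toMul w, rfl⟩
  set h' : Additive Fˣ →+ fixedSubgroup E K' σ := h.codRestrict _ hΦ with hh'
  have hsurj : Function.Surjective h' := by
    rintro ⟨P, hP⟩
    obtain ⟨a, ha⟩ := (mem_fixedSubgroup_iff_exists h2 hσ hd hx E hq1 f hfs hfk hfe P).mp hP
    exact ⟨Additive.ofMul a, Subtype.ext (by change h (Additive.ofMul a) = P; rw [happ, ha])⟩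
  -- so the relative index is the index of `M = h⁻¹(N E(K'))` in `Fˣ`
  set M : AddSubgroup (Additive Fˣ) := (normSubgroup E K' σ).comap h with hM
  have hrel : (normSubgroup E K' σ).relIndex (fixedSubgroup E K' σ) = M.index := by
    rw [AddSubgroup.relIndex, ← AddSubgroup.index_comap_of_surjective _ hsurj, hM,
      AddSubgroup.addSubgroupOf, AddSubgroup.comap_comap]
    rfl
  rw [hrel]
  -- `M` lies between `A = N_{K'/F} K'ˣ` and `A + ℤ q`
  set A : AddSubgroup (Additive Fˣ) := Subgroup.toAddSubgroup (quadraticNormSubgroup F d) with hAdef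
  have hA : A.index = 2 := by rw [hAdef, Subgroup.index_toAddSubgroup, hNm]
  have hAM : A ≤ M := by
    intro w hw
    rw [hAdef, Additive.mem_toAddSubgroup] at hw
    rw [hM, AddSubgroup.mem_comap,
      mem_normSubgroup_iff_exists h2 hσ hd hx E f hfs hfe]
    exact ⟨Additive.toMul w, hw, rfl⟩
  have hqM : Additive.ofMul (Units.mk0 q hq0) ∈ M := by
    rw [hM, AddSubgroup.mem_comap, happ,
      (map_algebraMap_eq_zero_iff (K' := K') E hq0 f hfk _).mpr ⟨1, by rw [zpow_one]⟩]
    exact zero_mem _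
  have hMle : M ≤ A ⊔ AddSubgroup.zmultiples (Additive.ofMul (Units.mk0 q hq0)) := by
    intro w hw
    rw [hM, AddSubgroup.mem_comap,
      mem_normSubgroup_iff_exists h2 hσ hd hx E f hfs hfe] at hw
    obtain ⟨b, hb, hbw⟩ := hw
    have h0 : h (w - Additive.ofMul b) = 0 := by rw [map_sub, happ, hbw, sub_self]
    have h0' : f (Additive.ofMul (Units.map (algebraMap F K' : F →* K')
        (Additive.toMul (w - Additive.ofMul b)))) = 0 := h0
    obtain ⟨n, hn⟩ := (map_algebraMap_eq_zero_iff (K' := K') E hq0 f hfk _).mp h0'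
    rw [AddSubgroup.mem_sup]
    refine ⟨Additive.ofMul b, by rwa [hAdef, Additive.mem_toAddSubgroup],
      n • Additive.ofMul (Units.mk0 q hq0), AddSubgroup.zsmul_mem_zmultiples _ n, ?_⟩
    have e : w - Additive.ofMul b = n • Additive.ofMul (Units.mk0 q hq0) := by
      rw [← ofMul_zpow, ← hn]; rfl
    rw [← e, add_sub_cancel]
  have key := index_eq_of_index_eq_two hA hAM hqM hMle
  simpa only [hAdef, Additive.mem_toAddSubgroup, toMul_ofMul] using key

end Index


/-! ## §8 Kramer 1981, Proposition 1 -/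

section Prop1

/-- **Kramer 1981, §2 Proposition 1 — PROVED** (Trans. AMS 264, p. 123): "Suppose that `E` is a
Tate curve. Then `i(K/F)` is `0` or `1`, according to whether `(Δ, d)_F` is `-1` or `+1`." Typed
EXACTLY as clause (1) of the named fact `props1_2a_multiplicativeNormIndex` (same binders, same
conclusion): for `F` a non-archimedean local field of characteristic `0`, `E/F` elliptic whose minimal
model has split multiplicative reduction, `K' ⊆ F̄` with `[K' : F] = 2`, `σ ≠ 1` in `Aut(K'/F)`,
`d` a non-square with a square root `x ∈ K'`: the index of `N E(K')` in `E(K')^σ = E(F)` is `1` if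
`(Δ, d)_F = -1` and `2` if `(Δ, d)_F = +1` (`Δ` the discriminant of the minimal model). Proof as
printed: `E(F)/N E(K) ≅ F*/(NK*)q^ℤ` (§§4–7, on Tate's uniformisation), `(F* : NK*) = 2` by local
class field theory (tree `index_normSubgroup_eq_finrank_holds`, Serre XIII §4 Prop. 9 / O'Meara
63:13a), `q ∈ NK* ⟺ (q, d)_F = 1 ⟺ (Δ, d)_F = 1` as `Δq⁻¹` is a square.
[cite: Kramer1981, §2 Prop. 1 and its proof (p. 123)] -/
theorem prop1_splitMultiplicativeNormIndex :
    ∀ (F : Type) [Field F] [ValuativeRel F] [TopologicalSpace F] [IsNonarchimedeanLocalField F]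
      [CharZero F] (E : WeierstrassCurve F) [E.IsElliptic]
      (K' : IntermediateField F (AlgebraicClosure F)) (_h2 : Module.finrank F K' = 2)
      (σ : K' ≃ₐ[F] K') (_hσ : σ ≠ 1) (d : F) (_hd : ¬ IsSquare d) (x : K')
      (_hx : x ^ 2 = algebraMap F K' d),
      (E.minimal 𝒪[F]).HasSplitMultiplicativeReduction 𝒪[F] →
        (hilbertSymbol F (E.minimal 𝒪[F]).Δ d = -1 →
            (normSubgroup E K' σ).relIndex (fixedSubgroup E K' σ) = 1) ∧
          (hilbertSymbol F (E.minimal 𝒪[F]).Δ d = 1 →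
            (normSubgroup E K' σ).relIndex (fixedSubgroup E K' σ) = 2) := by
  intro F _ _ _ _ _ E _ K' h2 σ hσ d hd x hx hsplit
  obtain ⟨q, hq0, -, hq1, ⟨c, hc⟩, hunif⟩ := exists_splitMultiplicative_uniformizer E hsplit
  obtain ⟨f, hfs, hfk, hfe⟩ := hunif K'
  have hNm : (quadraticNormSubgroup F d).index = 2 :=
    index_quadraticNormSubgroup_eq_two_of_index_normSubgroup_eq_finrank F
      (index_normSubgroup_eq_finrank_holds F) hd
  have key := relIndex_normSubgroup_fixedSubgroup_of_index_eq_two h2 hσ hd hx E hq0 hq1 f hfs hfk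
    hfe hNm
  -- `Δ q⁻¹` is a square, so `(Δ, d)_F = (q, d)_F`
  have hd0 : d ≠ 0 := fun h => hd ⟨0, by rw [h, mul_zero]⟩
  haveI : (E.minimal 𝒪[F]).IsElliptic := by
    change ((E.exists_isMinimal 𝒪[F]).choose • E).IsElliptic
    infer_instance
  have hΔ0 : (E.minimal 𝒪[F]).Δ ≠ 0 := (E.minimal 𝒪[F]).isUnit_Δ.ne_zero
  have hc0 : c ≠ 0 := by
    rintro rfl
    apply hΔ0
    rw [hc]; ring
  have hmem : Units.mk0 _ hΔ0 ∈ quadraticNormSubgroup F d ↔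
      Units.mk0 q hq0 ∈ quadraticNormSubgroup F d := by
    have e : Units.mk0 _ hΔ0 = Units.mk0 q hq0 * (Units.mk0 c hc0 * Units.mk0 c hc0) := by
      ext
      simp only [Units.val_mk0, Units.val_mul, hc]
      ring
    rw [e]
    constructor
    · intro h
      have h' := mul_mem h (inv_mem (mul_self_mem_quadraticNormSubgroup d (Units.mk0 c hc0)))
      rwa [mul_inv_cancel_right] at h'
    · intro h
      exact mul_mem h (mul_self_mem_quadraticNormSubgroup d _)
  constructor
  · intro hsym
    apply key.2
    rw [← hmem, ← hilbertSymbol_eq_neg_one_iff_not_mem_quadraticNormSubgroup hd0, Units.val_mk0]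
    exact hsym
  · intro hsym
    apply key.1
    rw [← hmem, ← hilbertSymbol_eq_one_iff_mem_quadraticNormSubgroup hd0, Units.val_mk0]
    exact hsym

end Prop1

end Literature.NumberTheory.EllipticCurves.Kramer1981

end
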